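import Summits.QuantumFields.YangMills.Theorems.BalabanUVNodesRateCarriersOfRecord13CoPH
import Literature.MathematicalPhysics.QuantumFieldTheory.Balaban1983to89.Node00.U3OfKernels
import Literature.MathematicalPhysics.QuantumFieldTheory.Balaban1983to89.Node00.Record8Inhabited

/-!
# NODE N22 (NE9) AT def-W1's KERNEL-KEYED NODE-U3 OBJECTS `Node00.U3OfKernels.objects ∕ objectsOfRecord₁₃` (W1-19, p590183):
# the N22 slot in KERNEL CURRENCY, the estimate-free (1.21) PASSAGE «windowed finite-volume bounds + existence of the limit ⇒ bounds on the
# limiting kernels», the PIN form for K3⁷ v2's `RatesHolderAt … N22At R.u3` conjunct, and a model-level inhabitant at the zero probe chart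

Cell `pub-ymgap`, Track A (HUMAN RULING D-0062), WIDTH SEAT `dag-n22-w3` g2 on node n22 = NE9; `--kind proof --supports stmt-QuantumFields-20544 --as helper`
(K3⁷ `SpineGivenEndpointR13SepCoPH`), COUNT-NEUTRAL.  The piece definer node00-def-W1 g29 named free on the bus (pub-ymgap INBOX l.25938, fork (β), Q2:
«N22 here would be … NE9 of the LIMITING kernels ((1.18) surviving (1.21)) — NO producer today»).

WHAT THE N22 SLOT SAYS AT THESE OBJECTS.  For a reading whose node-U3 objects are `U3OfKernels.objects F ℰ ρ bV ℓ` (generic remainder term family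
`ℰ : Node00.TermFamily1 F 𝔄` of [I] (2.13) ∕ [II] (2.13)–(2.14); probe `ρ`, basis `bV` of (1.20)'s Hessian; K-uniform letter block `ℓ`) — in particular
for the objects OF RECORD `objectsOfRecord₁₃ F N θ ℓ` (the merged term family of record) — the Stage-13 bundle `u3OfRecord₁₃ θ … k` is LEVEL-FREE
(`U3Objects₁₁.ofFixed`) and, under the displayed signs `ℓ.Signs`, `N22At` of it is `NE9 (U3OfKernels.EA F ℰ ρ bV) (Window θ.γ) ℓ.κ ℓ.moduli`
(layer B's `n22At_u3OfRecord₁₃_iff`: the fading-memory half holds by construction), i.e. by W1-19's `ne9_EA_iff` the JOINT HISTORY-LIPSCHITZ BOUNDS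
`|Π_{k+1,μν}(g_0…g_k; z) − Π_{k+1,μν}(g'_0…g'_k; z)| ≤ e^{−κ|z|₁} · Σ_{i≤k} C₉ ω^{k+1−i} |g_i − g'_i|` on the LIMITING (1.21) kernels
`kernelA F ℰ ρ bV g k = polLimit F (k+1) (ℰ k (g_0,…,g_k) ·) ρ bV` for every pair of coupling sequences of the window `]0, θ.γ]^ℕ` (§1 `…_iff`, §2 `…_iff`).

THE (1.21) PASSAGE (§1, ★).  [I] p. 264: «Now we take a limit of these functions as T^{(j+1)} ↗ Z^d. This limit exists by the localized
representation (1.7)»; the bounds of [I] ((1.18) p. 263, «uniform in the lattice spacing», p. 259) are proved AT FINITE VOLUME and SURVIVE the limit.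
Typed estimate-free: IF the windowed finite-volume kernels `Node00.polWindow F K (k+1) (ℰ k (g_0,…,g_k) K) ρ bV μ ν z` of def-B (`Node00/BetaOfRecord`)
obey the joint history-Lipschitz bound EVENTUALLY IN `K` (print: as soon as the `K`-th torus carries the scale-`(k+1)` step), AND def-B's NAMED existence
property `Node00.PolLimitExists` holds at both histories, THEN the limiting kernels obey the same bound (`le_of_tendsto`, `Tendsto.sub`, `Tendsto.abs`;
no rate of convergence, no estimate of Bałaban's) — `ne9Bound_kernelA_of_windowed`, `ne9_EA_of_windowed`, hence `N22At` at the objects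
(`n22At_u3OfRecord₁₃_objects_of_windowed`) and at the objects of record (`n22At_u3OfRecord₁₃_objectsOfRecord₁₃_of_windowed`).

THE PIN FORM (§2, ★★).  K3⁷ v2 (plan g79, skeleton 145a664ea9c38a7b) asks `RatesHolderAt D R β`'s conjunct `N22At R.u3` at the bundle of record
`R := rateCarriersOfRecord₁₃CoPH 𝔯 F θ hP g₀ os (ksel …)` of a residual Stage-13 rate reading `𝔯`; under the pin `(𝔯.lit F θ hP g₀ os).u3 =
objectsOfRecord₁₃ F N θ.toStage13Params ℓ` (the `hpin` shape of seat dag-n18-w2's `…N18U3GuardsAtKernels`, whose N18-SENSITIVE guard lives at the same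
objects, and of seat dag-n27-w1's (D4) producer `…N27ReadOutAtU3OfKernels`) the N22 conjunct holds AT EVERY RUN LENGTH from `ℓ.Signs` + the two displayed
inputs of the passage at the merged term family of record (`n22At_rateCarriers_of_kernels_pin`), or from `NE9` of the kernel functional of record outright
(`n22At_rateCarriers_of_kernels_pin_of_ne9`) — so ANY later producer of kernel-currency NE9 plugs in by name.

A6 (director-ym №189).  The two hypotheses of the passage are JOINTLY INHABITED AT MODEL LEVEL: at the ZERO PROBE CHART `ρ = 0` every windowed kernel
vanishes (`Node00.Record8Inhabited.polWindow_zeroChart`, seat dag-n23-b), so `PolLimitExists` holds (`polLimitExists_zeroChart`) and the windowed bounds hold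
with any moduli of the displayed signs; whence `n22At_u3OfRecord₁₃_objects_zeroChart` for EVERY term family — an honest DEGENERATE witness (the zero chart
is the cheap Stage-8 inhabitant's, not print's `su(N) ↪ M_N(ℂ)` chart); the record's chart `θ.ρ8` is NOT claimed to meet the hypotheses, so §2 is LOCATED
(hypothesis form) at the record.

CONSUMES BY NAME (nothing re-declared): W1-19 `Node00.U3OfKernels.{kernelA, EA, objects, objectsOfRecord₁₃, ne9_EA_iff, kernelA_eq, histPrefix}`;
def-B `Node00.{polWindow, polLimit, PolLimitExists, tendsto_polLimit}`; layer B `YMDAG.UVSplit.{u3OfRecord₁₃, n22At_u3OfRecord₁₃_iff,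
rateCarriersOfRecord₁₃CoPH}`; dag-n23-b `Node00.Record8Inhabited.polWindow_zeroChart`; RR-1 `Node00.U3Letters₁₁.{moduli, Signs}`.

HONEST FRAMING (binding).  Kernel bookkeeping + ONE `Filter.Tendsto` passage; THEOREMS ONLY (0 def, 0 sorry, standard axioms).  The windowed
history-Lipschitz bounds (= NE9 AT FINITE VOLUME — a cell NEW ESTIMATE, NOT PRINTED for d = 4: print gives C^∞ «(or analytic)» dependence on the LAST
coupling only, [I] p. 263, and that the earlier dependence exists, pp. 256, 298) and the existence of the (1.21) limit ([I] p. 264, a theorem of [I]∕[II])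
STAY DISPLAYED HYPOTHESES; nothing of Bałaban's is asserted; the kernel objects speak of the INFINITE-VOLUME family of [I] p. 264 (W1-19's and n27-w1's
HONEST LIMIT, repeated); N22 is NOT discharged; K3⁷ is OPEN and NOT claimed; no count claim (the chair's single count line is the only count); one finite
𝕋⁴ programme at fixed ε — R4 closes the CONDITIONAL rung `BalabanLadder.UV` only; NOTHING about the continuum limit, ℝ⁴, infinite volume, OS axioms, a
mass gap or the Clay problem is proved or claimed by any of this.  No decl below carries a cite tag (Summit side).
-/

noncomputable section

open Filter Topology
open scoped BigOperators

namespace YMDAG.N22.AtKernels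

open Literature.MathematicalPhysics.QuantumFieldTheory.Balaban1983to89
open Literature.MathematicalPhysics.QuantumFieldTheory.Balaban1983to89.T4Continuum (T4Family ULoop)
open Literature.MathematicalPhysics.QuantumFieldTheory.Balaban1983to89.T4OutputRate (Window NE9 FadingMemory)
open Literature.MathematicalPhysics.QuantumFieldTheory.Balaban1983to89.Node00 (TermFamily1 polWindow polLimit PolLimitExists tendsto_polLimit mergedTermFamilyMatT
  TβOfRecord₁₃ chiβOfRecord₁₃
  Stage13Params Stage13HParams U3Letters₁₁ U3Objects₁₁)
open Literature.MathematicalPhysics.QuantumFieldTheory.Balaban1983to89.Node00.U3OfKernels (carriers pt histPrefix kernelA EA EB objects objectsOfRecord₁₃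
  ne9_EA_iff kernelA_eq)
open Literature.MathematicalPhysics.QuantumFieldTheory.Balaban1983to89.Node00.Record8Inhabited (polWindow_zeroChart)
open Literature.MathematicalPhysics.QuantumFieldTheory.Balaban1983to89.B12Sec2to5 (l1)
open YMDAG.UVSplit (N22At u3OfRecord₁₃ n22At_u3OfRecord₁₃_iff RateReading₁₃CoPH rateCarriersOfRecord₁₃CoPH)

/-! ## §0 The limit tool (pure `Filter` bookkeeping) -/

/-- An eventual bound `|a K − b K| ≤ c` on two convergent real sequences passes to their limits: `|A − B| ≤ c`. -/
theorem abs_sub_le_of_tendsto_of_eventually_le {a b : ℕ → ℝ} {A B c : ℝ} (ha : Tendsto a atTop (𝓝 A)) (hb : Tendsto b atTop (𝓝 B))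
    (h : ∀ᶠ K in atTop, |a K - b K| ≤ c) : |A - B| ≤ c :=
  le_of_tendsto ((ha.sub hb).abs) h

/-! ## §1 Generic term family `ℰ`: the (1.21) passage, the N22 dictionary at `objects`, the zero-chart inhabitant -/

section Generic

variable {𝔄 : Type*} [NormedRing 𝔄] [NormedAlgebra ℝ 𝔄]
variable {V : Type*} [NormedAddCommGroup V] [NormedSpace ℝ V] {ι : Type*} [Fintype ι]
variable (F : T4Family) (ℰ : TermFamily1 F 𝔄) (ρ : V →L[ℝ] 𝔄) (bV : Module.Basis ι ℝ V)

/-- ★ **THE (1.21) PASSAGE FOR ONE KERNEL ENTRY**: a joint history-Lipschitz bound on the WINDOWED finite-volume kernels of level `k + 1` at two coupling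
sequences, holding eventually in the volume index `K`, together with the EXISTENCE of both (1.21) limits (def-B's named `PolLimitExists`), gives the same bound
on the limiting kernels `kernelA … g k μ ν z`, `kernelA … g' k μ ν z`.  No estimate: `le_of_tendsto`. -/
theorem ne9Bound_kernelA_of_windowed {g g' : ℕ → ℝ} {k : ℕ} {κ : ℝ} {Λ : ℕ → ℕ → ℝ} (μ ν : Fin 4) (z : Fin 4 → ℤ)
    (hg : PolLimitExists F (k + 1) (fun K => ℰ k (histPrefix g k) K) ρ bV)
    (hg' : PolLimitExists F (k + 1) (fun K => ℰ k (histPrefix g' k) K) ρ bV)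
    (hK : ∀ᶠ K in atTop,
      |polWindow F K (k + 1) (ℰ k (histPrefix g k) K) ρ bV μ ν z - polWindow F K (k + 1) (ℰ k (histPrefix g' k) K) ρ bV μ ν z| ≤
        Real.exp (-(κ * l1 z)) * ∑ i ∈ Finset.range (k + 1), Λ (k + 1) i * |g i - g' i|) :
    |kernelA F ℰ ρ bV g k μ ν z - kernelA F ℰ ρ bV g' k μ ν z| ≤
      Real.exp (-(κ * l1 z)) * ∑ i ∈ Finset.range (k + 1), Λ (k + 1) i * |g i - g' i| := by
  rw [kernelA_eq, kernelA_eq]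
  exact abs_sub_le_of_tendsto_of_eventually_le (tendsto_polLimit F (k + 1) _ ρ bV hg μ ν z) (tendsto_polLimit F (k + 1) _ ρ bV hg' μ ν z) hK

/-- ★ **NE9 OF THE KERNEL FUNCTIONAL FROM THE WINDOWED BOUNDS AND THE EXISTENCE OF THE LIMITS** on a window `W`: node U3's `NE9 (EA F ℰ ρ bV) W κ Λ`
(W1-19's `ne9_EA_iff` currency) from (i) `PolLimitExists` at every history of `W` and every level, (ii) the joint history-Lipschitz bounds on the windowed
finite-volume kernels, eventually in `K`.  Both inputs DISPLAYED; nothing asserted. -/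
theorem ne9_EA_of_windowed {W : Set (ℕ → ℝ)} {κ : ℝ} {Λ : ℕ → ℕ → ℝ}
    (hlim : ∀ g ∈ W, ∀ k : ℕ, PolLimitExists F (k + 1) (fun K => ℰ k (histPrefix g k) K) ρ bV)
    (hK : ∀ g ∈ W, ∀ g' ∈ W, ∀ (k : ℕ) (μ ν : Fin 4) (z : Fin 4 → ℤ), ∀ᶠ K in atTop,
      |polWindow F K (k + 1) (ℰ k (histPrefix g k) K) ρ bV μ ν z - polWindow F K (k + 1) (ℰ k (histPrefix g' k) K) ρ bV μ ν z| ≤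
        Real.exp (-(κ * l1 z)) * ∑ i ∈ Finset.range (k + 1), Λ (k + 1) i * |g i - g' i|) :
    NE9 (EA F ℰ ρ bV) W κ Λ :=
  (ne9_EA_iff F ℰ ρ bV W κ Λ).2 fun g hg g' hg' k μ ν z =>
    ne9Bound_kernelA_of_windowed F ℰ ρ bV μ ν z (hlim g hg k) (hlim g' hg' k) (hK g hg g' hg' k μ ν z)

/-- The same with the windowed bounds at EVERY volume index `K` (the `∀ K` form implies the eventual form). -/
theorem ne9_EA_of_windowed_forall {W : Set (ℕ → ℝ)} {κ : ℝ} {Λ : ℕ → ℕ → ℝ}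
    (hlim : ∀ g ∈ W, ∀ k : ℕ, PolLimitExists F (k + 1) (fun K => ℰ k (histPrefix g k) K) ρ bV)
    (hK : ∀ g ∈ W, ∀ g' ∈ W, ∀ (K k : ℕ) (μ ν : Fin 4) (z : Fin 4 → ℤ),
      |polWindow F K (k + 1) (ℰ k (histPrefix g k) K) ρ bV μ ν z - polWindow F K (k + 1) (ℰ k (histPrefix g' k) K) ρ bV μ ν z| ≤
        Real.exp (-(κ * l1 z)) * ∑ i ∈ Finset.range (k + 1), Λ (k + 1) i * |g i - g' i|) :
    NE9 (EA F ℰ ρ bV) W κ Λ :=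
  ne9_EA_of_windowed F ℰ ρ bV hlim fun g hg g' hg' k μ ν z => Eventually.of_forall fun K => hK g hg g' hg' K k μ ν z

variable {N : ℕ} [NeZero N]

/-- **THE N22 SLOT AT THE KERNEL OBJECTS IS NE9 OF THE KERNEL FUNCTIONAL** (level-free bundle; the fading-memory half holds by construction under the signs):
`N22At (u3OfRecord₁₃ θ (objects F ℰ ρ bV ℓ) k) ↔ NE9 (EA F ℰ ρ bV) (Window θ.γ) ℓ.κ ℓ.moduli`. -/
theorem n22At_u3OfRecord₁₃_objects_iff (θ : Stage13Params F N) (ℓ : U3Letters₁₁) (hs : ℓ.Signs) (k : ℕ) :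
    N22At (u3OfRecord₁₃ θ (objects F ℰ ρ bV ℓ) k) ↔ NE9 (EA F ℰ ρ bV) (Window θ.γ) ℓ.κ ℓ.moduli :=
  n22At_u3OfRecord₁₃_iff θ (objects F ℰ ρ bV ℓ) k hs

/-- **… SPELLED ON THE LIMITING KERNELS**: `N22At` at the kernel objects ⟺ for all coupling sequences `g, g'` of `]0, θ.γ]^ℕ`, all levels `j`, directions
`μ ν` and separations `z`, `|kernelA g j μ ν z − kernelA g' j μ ν z| ≤ e^{−κ|z|₁} Σ_{i<j+1} C₉ ω^{j+1−i} |g_i − g'_i|`. -/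
theorem n22At_u3OfRecord₁₃_objects_iff_kernels (θ : Stage13Params F N) (ℓ : U3Letters₁₁) (hs : ℓ.Signs) (k : ℕ) :
    N22At (u3OfRecord₁₃ θ (objects F ℰ ρ bV ℓ) k) ↔
      ∀ g ∈ Window θ.γ, ∀ g' ∈ Window θ.γ, ∀ (j : ℕ) (μ ν : Fin 4) (z : Fin 4 → ℤ),
        |kernelA F ℰ ρ bV g j μ ν z - kernelA F ℰ ρ bV g' j μ ν z| ≤
          Real.exp (-(ℓ.κ * l1 z)) * ∑ i ∈ Finset.range (j + 1), ℓ.C₉ * ℓ.ω ^ (j + 1 - i) * |g i - g' i| :=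
  (n22At_u3OfRecord₁₃_objects_iff F ℰ ρ bV θ ℓ hs k).trans (ne9_EA_iff F ℰ ρ bV (Window θ.γ) ℓ.κ ℓ.moduli)

/-- `N22At` at the kernel objects from `NE9` of the kernel functional (the `←` direction packaged for producers in `ne9_EA_iff` currency). -/
theorem n22At_u3OfRecord₁₃_objects_of_ne9 (θ : Stage13Params F N) (ℓ : U3Letters₁₁) (hs : ℓ.Signs) (k : ℕ)
    (h : NE9 (EA F ℰ ρ bV) (Window θ.γ) ℓ.κ ℓ.moduli) : N22At (u3OfRecord₁₃ θ (objects F ℰ ρ bV ℓ) k) :=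
  (n22At_u3OfRecord₁₃_objects_iff F ℰ ρ bV θ ℓ hs k).2 h

/-- ★ **N22 AT THE KERNEL OBJECTS FROM THE WINDOWED BOUNDS AND THE EXISTENCE OF THE LIMITS** (the (1.21) passage, packaged at the bundle): under the signs,
`PolLimitExists` along the window and the windowed joint history-Lipschitz bounds with moduli `C₉ ω^{k+1−i}` (eventually in `K`) give `N22At` at every run length. -/
theorem n22At_u3OfRecord₁₃_objects_of_windowed (θ : Stage13Params F N) (ℓ : U3Letters₁₁) (hs : ℓ.Signs) (k : ℕ)
    (hlim : ∀ g ∈ Window θ.γ, ∀ j : ℕ, PolLimitExists F (j + 1) (fun K => ℰ j (histPrefix g j) K) ρ bV)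
    (hK : ∀ g ∈ Window θ.γ, ∀ g' ∈ Window θ.γ, ∀ (j : ℕ) (μ ν : Fin 4) (z : Fin 4 → ℤ), ∀ᶠ K in atTop,
      |polWindow F K (j + 1) (ℰ j (histPrefix g j) K) ρ bV μ ν z - polWindow F K (j + 1) (ℰ j (histPrefix g' j) K) ρ bV μ ν z| ≤
        Real.exp (-(ℓ.κ * l1 z)) * ∑ i ∈ Finset.range (j + 1), ℓ.moduli (j + 1) i * |g i - g' i|) :
    N22At (u3OfRecord₁₃ θ (objects F ℰ ρ bV ℓ) k) :=
  n22At_u3OfRecord₁₃_objects_of_ne9 F ℰ ρ bV θ ℓ hs k (ne9_EA_of_windowed F ℰ ρ bV hlim hK)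

/-- **AT THE ZERO PROBE CHART THE (1.21) LIMITS EXIST** (every windowed kernel is `0`, dag-n23-b's `polWindow_zeroChart`; the constant sequence converges). -/
theorem polLimitExists_zeroChart (j : ℕ) (ℰK : (K : ℕ) → (Fin (F.P K).d → Site (F.P K) j → 𝔄) → ℝ) :
    PolLimitExists F j ℰK (0 : V →L[ℝ] 𝔄) bV := by
  intro μ ν z
  refine ⟨0, ?_⟩
  simp only [polWindow_zeroChart]
  exact tendsto_const_nhds

/-- **A6 — MODEL-LEVEL INHABITANT OF THE PASSAGE'S HYPOTHESES**: at the zero probe chart `ρ = 0` the windowed kernels vanish identically, so both displayed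
inputs of `n22At_u3OfRecord₁₃_objects_of_windowed` hold and `N22At` holds at the kernel objects for EVERY term family `ℰ`, every Stage-13 tuple and every letter
block of the displayed signs.  HONEST: a DEGENERATE witness (the cheap Stage-8 inhabitant's chart), not print's `su(N) ↪ M_N(ℂ)` chart; it certifies only that the
hypothesis shape is jointly satisfiable. -/
theorem n22At_u3OfRecord₁₃_objects_zeroChart (θ : Stage13Params F N) (ℓ : U3Letters₁₁) (hs : ℓ.Signs) (k : ℕ) :
    N22At (u3OfRecord₁₃ θ (objects F ℰ (0 : V →L[ℝ] 𝔄) bV ℓ) k) := by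
  refine n22At_u3OfRecord₁₃_objects_of_windowed F ℰ 0 bV θ ℓ hs k (fun g _ j => polLimitExists_zeroChart F bV (j + 1) _) ?_
  intro g _ g' _ j μ ν z
  refine Eventually.of_forall fun K => ?_
  rw [polWindow_zeroChart, polWindow_zeroChart, sub_self, abs_zero]
  exact mul_nonneg (Real.exp_nonneg _) (Finset.sum_nonneg fun i _ => mul_nonneg (hs.moduli_nonneg _ _) (abs_nonneg _))

end Generic

/-! ## §2 At the record, Stage 13: the objects of record `objectsOfRecord₁₃ F N θ ℓ` and the PIN form for K3⁷ v2 -/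

section Record

open scoped Matrix.Norms.L2Operator

variable (F : T4Family) (N : ℕ) [NeZero N]

/-- **THE N22 SLOT AT THE KERNEL OBJECTS OF RECORD IS NE9 OF THE KERNEL FUNCTIONAL OF RECORD** (level-free; merged term family of record, the record's β-chart). -/
theorem n22At_u3OfRecord₁₃_objectsOfRecord₁₃_iff (θ : Stage13Params F N) (ℓ : U3Letters₁₁) (hs : ℓ.Signs) (k : ℕ) :
    N22At (u3OfRecord₁₃ θ (objectsOfRecord₁₃ F N θ ℓ) k) ↔ NE9 ((objectsOfRecord₁₃ F N θ ℓ).EA k) (Window θ.γ) ℓ.κ ℓ.moduli :=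
  n22At_u3OfRecord₁₃_iff θ (objectsOfRecord₁₃ F N θ ℓ) k hs

/-- **… SPELLED ON THE LIMITING KERNELS OF RECORD** (`(objectsOfRecord₁₃ …).EA j g U (pt j μ ν z)` IS `polLimit` of the merged term of record, W1-19's
`objectsOfRecord₁₃_EA_pt`): `N22At` ⟺ the joint history-Lipschitz bounds `≤ e^{−κ|z|₁} Σ_{i<j+1} C₉ ω^{j+1−i} |g_i − g'_i|` on them, window `]0, θ.γ]^ℕ`. -/
theorem n22At_u3OfRecord₁₃_objectsOfRecord₁₃_iff_kernels (θ : Stage13Params F N) (ℓ : U3Letters₁₁) (hs : ℓ.Signs) (k : ℕ) :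
    N22At (u3OfRecord₁₃ θ (objectsOfRecord₁₃ F N θ ℓ) k) ↔
      ∀ g ∈ Window θ.γ, ∀ g' ∈ Window θ.γ, ∀ (j : ℕ) (μ ν : Fin 4) (z : Fin 4 → ℤ),
        |(objectsOfRecord₁₃ F N θ ℓ).EA j g PUnit.unit (pt j μ ν z) - (objectsOfRecord₁₃ F N θ ℓ).EA j g' PUnit.unit (pt j μ ν z)| ≤
          Real.exp (-(ℓ.κ * l1 z)) * ∑ i ∈ Finset.range (j + 1), ℓ.C₉ * ℓ.ω ^ (j + 1 - i) * |g i - g' i| := by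
  letI := θ.instVβ₁; letI := θ.instVβ₂; letI := θ.instιβ
  exact n22At_u3OfRecord₁₃_objects_iff_kernels F _ θ.ρ8 θ.bV θ ℓ hs k

/-- ★ **N22 AT THE KERNEL OBJECTS OF RECORD FROM THE WINDOWED BOUNDS OF RECORD AND THE EXISTENCE OF THE (1.21) LIMITS OF RECORD** (LOCATED: both inputs are
displayed hypotheses at the merged term family of record `mergedTermFamilyMatT F N (TβOfRecord₁₃ F N) (chiβOfRecord₁₃ F N θ) θ.εbg` read in the record's β-chart
`θ.ρ8 ∕ θ.bV`; nothing of the record is claimed to meet them). -/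
theorem n22At_u3OfRecord₁₃_objectsOfRecord₁₃_of_windowed (θ : Stage13Params F N) (ℓ : U3Letters₁₁) (hs : ℓ.Signs) (k : ℕ)
    (hlim : letI := θ.instVβ₁; letI := θ.instVβ₂; letI := θ.instιβ
      ∀ g ∈ Window θ.γ, ∀ j : ℕ,
        PolLimitExists F (j + 1) (fun K => mergedTermFamilyMatT F N (TβOfRecord₁₃ F N) (chiβOfRecord₁₃ F N θ) θ.εbg j (histPrefix g j) K) θ.ρ8 θ.bV)
    (hK : letI := θ.instVβ₁; letI := θ.instVβ₂; letI := θ.instιβ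
      ∀ g ∈ Window θ.γ, ∀ g' ∈ Window θ.γ, ∀ (j : ℕ) (μ ν : Fin 4) (z : Fin 4 → ℤ), ∀ᶠ K in atTop,
        |polWindow F K (j + 1) (mergedTermFamilyMatT F N (TβOfRecord₁₃ F N) (chiβOfRecord₁₃ F N θ) θ.εbg j (histPrefix g j) K) θ.ρ8 θ.bV μ ν z -
            polWindow F K (j + 1) (mergedTermFamilyMatT F N (TβOfRecord₁₃ F N) (chiβOfRecord₁₃ F N θ) θ.εbg j (histPrefix g' j) K) θ.ρ8 θ.bV μ ν z| ≤
          Real.exp (-(ℓ.κ * l1 z)) * ∑ i ∈ Finset.range (j + 1), ℓ.moduli (j + 1) i * |g i - g' i|) :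
    N22At (u3OfRecord₁₃ θ (objectsOfRecord₁₃ F N θ ℓ) k) := by
  letI := θ.instVβ₁; letI := θ.instVβ₂; letI := θ.instιβ
  exact n22At_u3OfRecord₁₃_objects_of_windowed F _ θ.ρ8 θ.bV θ ℓ hs k hlim hK

variable {N}

/-- ★★ **THE PIN FORM FOR K3⁷ v2, FROM NE9 OF THE KERNEL FUNCTIONAL OF RECORD**: for a residual Stage-13 rate reading `𝔯` whose node-U3 objects at the tuple
ARE the kernel objects of record (`hpin`, the shape of dag-n18-w2's guard file and dag-n27-w1's (D4) producer), the N22 conjunct `N22At R.u3` of `RatesHolderAt`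
holds at the bundle of EVERY run length `k` as soon as `NE9` of the kernel functional of record holds on the window — so any producer of kernel-currency NE9
plugs in here by name. -/
theorem n22At_rateCarriers_of_kernels_pin_of_ne9 (𝔯 : RateReading₁₃CoPH N) {F : T4Family} (θ : Stage13HParams F N) (hP : θ.Provisos₁₃CoPH F N)
    (g₀ : ℕ → ℝ) (os : List (ULoop F)) (ℓ : U3Letters₁₁) (hs : ℓ.Signs)
    (hpin : (𝔯.lit F θ hP g₀ os).u3 = objectsOfRecord₁₃ F N θ.toStage13Params ℓ)
    (h9 : NE9 ((objectsOfRecord₁₃ F N θ.toStage13Params ℓ).EA 0) (Window θ.γ) ℓ.κ ℓ.moduli) (k : ℕ) :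
    N22At (rateCarriersOfRecord₁₃CoPH 𝔯 F θ hP g₀ os k).u3 := by
  show N22At (u3OfRecord₁₃ θ.toStage13Params (𝔯.lit F θ hP g₀ os).u3 k)
  rw [hpin]
  exact (n22At_u3OfRecord₁₃_objectsOfRecord₁₃_iff F N θ.toStage13Params ℓ hs k).2 h9

/-- ★★ **THE PIN FORM FOR K3⁷ v2, FROM THE WINDOWED BOUNDS OF RECORD AND THE EXISTENCE OF THE (1.21) LIMITS OF RECORD**: under `hpin`, `ℓ.Signs` and the two
displayed inputs of the (1.21) passage at the merged term family of record, `N22At (rateCarriersOfRecord₁₃CoPH 𝔯 F θ hP g₀ os k).u3` for EVERY `k` — the v2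
`KeyedRatesHolderD4`'s N22 conjunct shape at every selector value.  LOCATED (hypothesis form); N22 NOT discharged. -/
theorem n22At_rateCarriers_of_kernels_pin (𝔯 : RateReading₁₃CoPH N) {F : T4Family} (θ : Stage13HParams F N) (hP : θ.Provisos₁₃CoPH F N)
    (g₀ : ℕ → ℝ) (os : List (ULoop F)) (ℓ : U3Letters₁₁) (hs : ℓ.Signs)
    (hpin : (𝔯.lit F θ hP g₀ os).u3 = objectsOfRecord₁₃ F N θ.toStage13Params ℓ)
    (hlim : letI := θ.instVβ₁; letI := θ.instVβ₂; letI := θ.instιβ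
      ∀ g ∈ Window θ.γ, ∀ j : ℕ,
        PolLimitExists F (j + 1)
          (fun K => mergedTermFamilyMatT F N (TβOfRecord₁₃ F N) (chiβOfRecord₁₃ F N θ.toStage13Params) θ.εbg j (histPrefix g j) K) θ.ρ8 θ.bV)
    (hK : letI := θ.instVβ₁; letI := θ.instVβ₂; letI := θ.instιβ
      ∀ g ∈ Window θ.γ, ∀ g' ∈ Window θ.γ, ∀ (j : ℕ) (μ ν : Fin 4) (z : Fin 4 → ℤ), ∀ᶠ K in atTop,
        |polWindow F K (j + 1)
              (mergedTermFamilyMatT F N (TβOfRecord₁₃ F N) (chiβOfRecord₁₃ F N θ.toStage13Params) θ.εbg j (histPrefix g j) K) θ.ρ8 θ.bV μ ν z -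
            polWindow F K (j + 1)
              (mergedTermFamilyMatT F N (TβOfRecord₁₃ F N) (chiβOfRecord₁₃ F N θ.toStage13Params) θ.εbg j (histPrefix g' j) K) θ.ρ8 θ.bV μ ν z| ≤
          Real.exp (-(ℓ.κ * l1 z)) * ∑ i ∈ Finset.range (j + 1), ℓ.moduli (j + 1) i * |g i - g' i|)
    (k : ℕ) : N22At (rateCarriersOfRecord₁₃CoPH 𝔯 F θ hP g₀ os k).u3 := by
  show N22At (u3OfRecord₁₃ θ.toStage13Params (𝔯.lit F θ hP g₀ os).u3 k)
  rw [hpin]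
  exact n22At_u3OfRecord₁₃_objectsOfRecord₁₃_of_windowed F N θ.toStage13Params ℓ hs k hlim hK

end Record

end YMDAG.N22.AtKernels

end
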